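import Summits.ResolutionOfSingularities.ResolutionOfSingularities.Theorems.FrobeniusClosingPatchingRelPerfectTwoPlanesPlanePow
import Summits.ResolutionOfSingularities.ResolutionOfSingularities.Theorems.FrobeniusClosingPatchingRelPerfectTwoPlanesLevelTwoUnit
import Literature.AlgebraicGeometry.Resolution.RegularCentreLocal
import Mathlib.RingTheory.MvPolynomial.Localization
import HarnessLib

/-!
# Crux `PatchingRelPerfect` (stmt-ResolutionOfSingularities-16161), chain w52 — the rank-two member
# `f = x₀x₁ + x₂³`: the chart `B₁` of `Bl_𝔪` (plane step, unit variant of the `t`-chart)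

[OURS · L1 W5.2 · rung, piece R2 of the design note NEXT-two-planes-cube.md, Add. 11–12]  On the
chart `B₁ = S[x/x₁]` the strict transform of `f` is `e₀·1 + u e₂³` (`e₁ = x₁/x₁ = 1`), so after
the plane step `Bl_{(u,e₀)}` the `t`-chart flag collapses to `(c, w)²` (`…TwoPlanesLevelTwoUnit`)
with `C/(c, w) ≅ (B₁/(u,e₀))[X]/(1 + X ē₂³) ≅ (B₁/(u,e₀))[1/ē₂³]` — a LOCALISATION of a regular
ring, hence regular — and the `s`-chart exceptional curve is the graph `S + ē₂³` (`…PolyShear`).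
PROVED:

* `isRegularRing_quot_span_one_add_X_mul_C` — `R[X]/(1 + X r) ≅ R[1/(−r)]` is regular for `R`
  regular (Mathlib `IsLocalization.Away.mvPolynomialQuotientEquiv`);
* `chartOne_hPr`, `chartOne_sFacts` — the three level-two facts on `B₁`;
* `isRegular_of_isBlowup_tpPlane_coreOne` — **every blowing up of `Spec B₁` along
  `(u)ᵃ · ((J₁ · (u,e₀)^m) · (u,e₀))` is regular**, unconditionally (`J₁` the image of `A₃ A₄ I`
  divided by `u⁶`; `(u,e₀)^m` the twist by the avatars `J_q`, `J_π`).

The `S`-level image identity of the full companion on `B₁` follows in the sequel (after the chart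
images of `J_π`).  Nothing here is a statement of the manuscript under review.

## References

* The Stacks Project, Tags 080A, 080B, 0BIQ, 00S9. [StacksProject]
-/

-- `Summit.<Summit>.<Sub>.Theorems` with `Sub = Summit` (single-conjunct summit, D-0017)
set_option linter.dupNamespace false

noncomputable section

open CategoryTheory CategoryTheory.Limits AlgebraicGeometry Literature.AlgebraicGeometry.Resolution
open IsLocalRing

namespace Summit.ResolutionOfSingularities.ResolutionOfSingularities.Theorems

namespace TwoPlanesRung

open ConeRung

universe u

/-! ## Algebra: `R[X]/(1 + X r)` is a localisation of `R` -/

/-- **`R[X] ⧸ (1 + X·r)` is a regular ring when `R` is** (one variable `X = X_v`, `σ ≃ Unit`):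
it is `R[X]/(C(−r) X − 1) ≅ R[1/(−r)]` (Mathlib), a localisation of a regular ring.
[cite: StacksProject, Tag 00S9] -/
theorem isRegularRing_quot_span_one_add_X_mul_C {R : Type u} [CommRing R] [IsRegularRing R]
    {σ : Type} (e : σ ≃ Unit) (v : σ) (r : R) :
    IsRegularRing (MvPolynomial σ R ⧸ Ideal.span {1 + MvPolynomial.X v * MvPolynomial.C r}) := by
  let ρ : MvPolynomial σ R ≃+* MvPolynomial Unit R := (MvPolynomial.renameEquiv R e).toRingEquiv
  have hρ : ρ (1 + MvPolynomial.X v * MvPolynomial.C r) =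
      -(MvPolynomial.C (-r) * MvPolynomial.X () - 1) := by
    change MvPolynomial.rename e (1 + MvPolynomial.X v * MvPolynomial.C r) = _
    rw [map_add, map_one, map_mul, MvPolynomial.rename_X, MvPolynomial.rename_C, MvPolynomial.C_neg,
      show e v = () from Subsingleton.elim _ _]
    ring
  have hmap : Ideal.span {MvPolynomial.C (-r) * MvPolynomial.X () - 1} =
      (Ideal.span {1 + MvPolynomial.X v * MvPolynomial.C r}).map (ρ : _ →+* _) := by
    rw [Ideal.map_span, Set.image_singleton, RingHom.coe_coe, hρ, Ideal.span_singleton_neg]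
  let E := Ideal.quotientEquiv _ _ ρ hmap
  haveI : IsRegularRing (Localization.Away (-r)) :=
    isRegularRing_of_isLocalization (Submonoid.powers (-r)) _
  haveI : IsRegularRing (MvPolynomial Unit R ⧸ Ideal.span {MvPolynomial.C (-r) * MvPolynomial.X () - 1}) :=
    IsRegularRing.of_ringEquiv
      (IsLocalization.Away.mvPolynomialQuotientEquiv (Localization.Away (-r)) (-r)).toRingEquiv.symm
  exact IsRegularRing.of_ringEquiv E.symm

/-- `X_v + C r ≠ 0` over a non-trivial ring. [folklore] -/
theorem X_add_C_ne_zero' {R : Type*} [CommRing R] [Nontrivial R] {σ : Type*} (v : σ) (r : R) :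
    (MvPolynomial.X v + MvPolynomial.C r : MvPolynomial σ R) ≠ 0 := by
  classical
  intro h
  have h1 := congrArg (MvPolynomial.coeff (Finsupp.single v 1)) h
  rw [MvPolynomial.coeff_add, MvPolynomial.coeff_C, MvPolynomial.coeff_zero,
    if_neg (Finsupp.single_ne_zero.mpr one_ne_zero).symm, add_zero, MvPolynomial.coeff_X,
    if_pos rfl] at h1
  exact one_ne_zero h1

section ChartOne

variable {S : Type u} [CommRing S] [IsRegularLocalRing S] (x : Fin 4 → S)
  (hx : Ideal.span (Set.range x) = IsLocalRing.maximalIdeal S)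
  (hd : (IsLocalRing.maximalIdeal S).spanFinrank = 4)

local notation3 "M" => Ideal.span (Set.range x)
local notation3 "B" => chartRing x 1
local notation3 "uB" => chartBase x 1 (x 1)
local notation3 "e[" j "]" => chartGen x 1 j
local notation3 "U" => Ideal.span {chartBase x 1 (x 1)}
/-- the plane centre `(u, e₀)` as a chart family and its ideal -/
local notation3 (prettyPrint := false) "cc" => (Fin.cons (chartBase x 1 (x 1)) (fun _ : Fin 1 => chartGen x 1 0) : Fin 2 → chartRing x 1)
local notation3 (prettyPrint := false) "II" => Ideal.span (Set.range
  (Fin.cons (chartBase x 1 (x 1)) (fun _ : Fin 1 => chartGen x 1 0) : Fin 2 → chartRing x 1))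
/-- the three later companion factors on `B₁` (divided by `u²` each) -/
local notation3 (prettyPrint := false) "J" => Ideal.span {chartGen x 1 0 * chartGen x 1 1, chartBase x 1 (x 1)} *
    (Ideal.span {chartGen x 1 0 * chartGen x 1 1 + chartBase x 1 (x 1) * chartGen x 1 2 ^ 3} ⊔
      Ideal.span {chartBase x 1 (x 1)} * Ideal.span {chartGen x 1 0} ⊔ Ideal.span {chartBase x 1 (x 1)} ^ 2) *
    (Ideal.span {chartGen x 1 0 * chartGen x 1 1 + chartBase x 1 (x 1) * chartGen x 1 2 ^ 3} ⊔
      Ideal.span {chartBase x 1 (x 1)} ^ 2)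
/-- the exceptional-curve models of the two level-two charts -/
local notation3 (prettyPrint := false) "PP" => MvPolynomial {j : Fin 2 // j ≠ Fin.succ 0} (chartRing x 1 ⧸ II)
local notation3 (prettyPrint := false) "gFlat" => (MvPolynomial.C (Ideal.Quotient.mk II (chartGen x 1 1)) :
    MvPolynomial {j : Fin 2 // j ≠ Fin.succ 0} (chartRing x 1 ⧸ II))
  + MvPolynomial.X (⟨0, (Fin.succ_ne_zero 0).symm⟩ : {j : Fin 2 // j ≠ Fin.succ 0}) *
    MvPolynomial.C (Ideal.Quotient.mk II (chartGen x 1 2 ^ 3))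
local notation3 (prettyPrint := false) "PP₀" => MvPolynomial {j : Fin 2 // j ≠ 0} (chartRing x 1 ⧸ II)
local notation3 (prettyPrint := false) "hFlat" => MvPolynomial.X (⟨1, one_ne_zero_fin2⟩ : {j : Fin 2 // j ≠ 0}) *
    (MvPolynomial.C (Ideal.Quotient.mk II (chartGen x 1 1)) : MvPolynomial {j : Fin 2 // j ≠ 0} (chartRing x 1 ⧸ II))
  + MvPolynomial.C (Ideal.Quotient.mk II (chartGen x 1 2 ^ 3))

/-- `0 ≠ 1` in `Fin 4`. [folklore] -/
theorem zero_ne_one_fin4 : (0 : Fin 4) ≠ 1 := by decide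

include hx hd in
/-- `B₁ ⧸ (u, e₀)` is a regular ring (a polynomial ring over the residue field).
[cite: StacksProject, Tag 0BIQ] -/
theorem isRegularRing_quot_plane_one : IsRegularRing (B ⧸ II) := by
  haveI := isRegularRing_residue x hx
  exact isRegularRing_quot_cons_chartGen x 1 (fun _ : Fin 1 => (⟨0, zero_ne_one_fin4⟩ : {j : Fin 4 // j ≠ 1}))
    (isQuasiRegular_regularSystemOfParameters hd x hx)

include hx hd in
/-- **Fact `hPr` on `B₁`**: `(B₁/(u,e₀))[X] ⧸ (ē₁ + X ē₂³)`, `ē₁ = 1`, is a regular ring.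
[cite: StacksProject, Tag 00S9] -/
theorem chartOne_hPr : IsRegularRing (PP ⧸ Ideal.span {gFlat}) := by
  haveI := isRegularRing_quot_plane_one x hx hd
  have h11 : chartGen x 1 1 = 1 := chartGen_self x 1
  rw [h11, map_one, MvPolynomial.C_1]
  let e : {j : Fin 2 // j ≠ Fin.succ 0} ≃ Unit :=
    { toFun := fun _ => ()
      invFun := fun _ => ⟨0, (Fin.succ_ne_zero 0).symm⟩
      left_inv := fun j => Subtype.ext ((Fin.eq_zero_or_eq_succ j.1).elim (fun h => h.symm)
        fun ⟨k, hk⟩ => absurd (hk.trans (congrArg Fin.succ (Subsingleton.elim k 0))) j.2)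
      right_inv := fun _ => rfl }
  exact isRegularRing_quot_span_one_add_X_mul_C e _ _

include hx hd in
/-- **Facts `hQr`, `hQ0` on `B₁`**: `(B₁/(u,e₀))[S] ⧸ (S ē₁ + ē₂³)`, `ē₁ = 1`, is a regular ring
(a graph, `…PolyShear`) and `S ē₁ + ē₂³ ≠ 0`. [cite: StacksProject, Tag 00S9] -/
theorem chartOne_sFacts : IsRegularRing (PP₀ ⧸ Ideal.span {hFlat}) ∧ hFlat ≠ 0 := by
  classical
  haveI := isRegularRing_quot_plane_one x hx hd
  haveI : IsDomain (B ⧸ II) := isDomain_quot_plane x hx hd 1 zero_ne_one_fin4.symm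
  have h11 : chartGen x 1 1 = 1 := chartGen_self x 1
  rw [h11, map_one, MvPolynomial.C_1, mul_one]
  exact ⟨PolyShear.isRegularRing_quot_span_X_add (⟨1, one_ne_zero_fin2⟩ : {j : Fin 2 // j ≠ 0})
    (by rw [MvPolynomial.vars_C]; exact Finset.notMem_empty _), X_add_C_ne_zero' _ _⟩

include hx hd in
/-- **The chart `B₁`: every blowing up of `Spec B₁` along `(u)ᵃ · ((J₁ · (u,e₀)^m) · (u,e₀))` is
regular** — plane step (`isRegular_of_isBlowup_mul_of_charts`), `s`-chart by the graph, `t`-chart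
by the unit variant `(c, w)²`. [cite: StacksProject, Tag 080A] [cite: StacksProject, Tag 080B] -/
theorem isRegular_of_isBlowup_tpPlane_coreOne (m a : ℕ)
    {Y : Scheme.{u}} {ρ : Y ⟶ Spec (.of B)}
    (hρ : IsBlowup ρ (affineBlowup.idealSheaf (Ideal.span {uB ^ a} * ((J * II ^ m) * II)))) :
    Scheme.IsRegular Y := by
  haveI : IsDomain S := isDomain_of_isRegularLocalRing S
  have hqr := isQuasiRegular_regularSystemOfParameters hd x hx
  haveI hBr : IsRegularRing B := isRegularRing_chart x hx hd 1
  haveI := isRegularRing_residue x hx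
  haveI := isDomain_residue x hx
  have hx1 : x 1 ≠ 0 := (isRsopPart_comp_of_rsop hd x hx id Function.injective_id).ne_zero 1
  haveI hB : IsDomain B := isDomain_chartRing x 1 hx1
  haveI hdII : IsDomain (B ⧸ II) := isDomain_quot_plane x hx hd 1 zero_ne_one_fin4.symm
  haveI hrII : IsRegularRing (B ⧸ II) := isRegularRing_quot_plane_one x hx hd
  have hc : IsQuasiRegular cc :=
    isQuasiRegular_cons_chartGen x 1 (fun _ : Fin 1 => (⟨0, zero_ne_one_fin4⟩ : {j : Fin 4 // j ≠ 1})) hqr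
      (Function.injective_of_subsingleton _)
  have he : e[0] ∉ U := chartGen_notMem_span_u x hx hd 1 0 zero_ne_one_fin4
  have hu : uB ∈ nonZeroDivisors B :=
    reesChartBase_mem_nonZeroDivisors (x 1) (Ideal.mem_span_range_self (f := x) (x := 1))
  have hu0 : uB ≠ 0 := nonZeroDivisors.ne_zero hu
  obtain ⟨hQr, hQ0⟩ := chartOne_sFacts x hx hd
  have hPr := chartOne_hPr x hx hd
  have h0 := fun (Y' : Scheme.{u}) (ρ' : Y' ⟶ Spec (.of (chartRing cc 0)))
      (h' : IsBlowup ρ' (affineBlowup.idealSheaf ((J * II ^ m).map (chartBase cc 0)))) =>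
    tpPlane_chartPow_zero x 1 m hc hB hBr hdII hrII hu0 hQr hQ0 h'
  have h1 : ∀ (Y' : Scheme.{u}) (ρ' : Y' ⟶ Spec (.of (chartRing cc (Fin.succ 0)))),
      IsBlowup ρ' (affineBlowup.idealSheaf ((J * II ^ m).map (chartBase cc (Fin.succ 0)))) →
        Scheme.IsRegular Y' := fun Y' ρ' h' => by
    rw [map_mul_pow_plane_chart] at h'
    exact CoreRungTower.isRegular_of_isBlowup_span_singleton_mul
      (pow_mem (reesChartBase_mem_nonZeroDivisors (cc (Fin.succ 0))
        (Ideal.mem_span_range_self (f := cc) (x := Fin.succ 0))) m) _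
      (fun Y'' ρ'' h'' => isRegular_of_isBlowup_tpProd_t_one uB e[0] e[1] (e[2] ^ 3)
        (chartGen_self x 1) hc he hPr h'') h'
  have hcharts : ∀ (k : Fin 2) (Y' : Scheme.{u}) (ρ' : Y' ⟶ Spec (.of (chartRing cc k))),
      IsBlowup ρ' (affineBlowup.idealSheaf ((J * II ^ m).map (chartBase cc k))) → Scheme.IsRegular Y' :=
    Fin.forall_fin_two.mpr ⟨h0, h1⟩
  exact CoreRungTower.isRegular_of_isBlowup_span_singleton_mul (pow_mem hu a) _
    (fun Y' ρ' h' => isRegular_of_isBlowup_mul_of_charts cc (J * II ^ m) hcharts h') hρ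

end ChartOne

end TwoPlanesRung

end Summit.ResolutionOfSingularities.ResolutionOfSingularities.Theorems

end
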